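import Summits.CriticalPhenomena.PercolationContinuityZ3.Theorems.PercLowPointHalfSpaceTallClusterMassBoundStubFirstMomentTransfer
import Literature.Probability.Percolation.SharpnessDCTProofs
import HarnessLib

/-!
# `TallClusterMassBound` (stmt-CriticalPhenomena-0912), line `SketchIdeator4` — ARROW 1's logarithm
# is necessary uniformly in `p`

Helper stubs of the skeleton `Cruxes/TallClusterMassBound/Lines/SketchIdeator4.lean`
(crux `…Theses.PercLowPointHalfSpace.TallClusterMassBound`, item B of route PercLowPointHalfSpace).

ARROW 1 of the line reads, for EVERY `p` and `r`,
`M_p(r) ≤ K · typicalMax P^ℍ_p Λ_r · π_p(r) · (1 + log(1/π_p(r)))` (`Λ_r = halfBox r`,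
`P^ℍ_p = floorDilutedPercolation 3 p 1`, `π_p(r) = armProb p r`, `M_p(r) = mass p r`). This file shows
that the logarithm cannot be dropped by any argument uniform in `p`: for `0 < p < p_c(ℤ³)`,

* `typicalMax_le_log_cube_of_lt_criticalProb` — the subcritical typical maximum is polylogarithmic,
  `typicalMax P^ℍ_p Λ_r ≤ C_p (1 + log r)³` (`r ≥ 1`). Proof: sharpness of the phase transition
  (`DCT16.perc_sharpness_holds`, `P_p(0 ↔ ∂Λ_m) ≤ e^{-cm}`) and the first exit
  `{|C(0)| ≥ n} ⊆ {0 ↔ ∂Λ_m}` a.s. for `n > |Λ_m| = (2m+1)³` give the bulk volume tail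
  `P_p(|C(0)| ≥ n) ≤ e^{-cm}`; the first-moment chain of ENGINE 2
  (`StubFirstMomentTransfer`: Markov on the number of `v ∈ Λ_r` with `|K_v ∩ Λ_r| ≥ n`,
  `{|K_v ∩ Λ_r| ≥ n} ⊆ {|K_v| ≥ n}`, `P^ℍ_p ≤ P_p` on increasing events, translation invariance,
  `|Λ_r| ≤ 27 r³`) gives `P^ℍ_p(|K_max(Λ_r)| ≥ n) ≤ 27 r³ e^{-cm} ≤ e^{-1}` for
  `m = ⌈(27 + 3 log r)/c⌉`, whence `typicalMax ≤ (2m+1)³ + 1 ≤ ((54/c + 3)³ + 1)(1 + log r)³`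
  by the minimality of the typical value;
* `not_massLeTypicalMax_logfree_of_lt_criticalProb` — the log-free ARROW 1
  `M_p(r) ≤ K · typicalMax · π_p(r)` (`r ≥ 1`) is FALSE: `M_p(r) ≥ (r+1) π_p(r)`
  (`succ_mul_armProb_le_mass`) and `π_p(r) > 0` (`armProb_pos`) would give
  `r + 1 ≤ K C_p (1 + log r)³ ≤ 125 K C_p r^{3/4}` for all `r ≥ 1`, absurd.
No definitions.
-/

noncomputable section

open MeasureTheory Finset Filter
open Literature.Probability.Percolation Literature.Probability.LatticeModels
open Summit.CriticalPhenomena.PercolationContinuityZ3.Theorems.TallClusterMassBound.Negative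

namespace Summit.CriticalPhenomena.PercolationContinuityZ3.Theorems.TallClusterMassBound.TightnessLine

/-! ## §1 The bulk volume tail below `p_c` from sharpness -/

/-- **First exit: a large cluster reaches the boundary of a small box.** If `n > |Λ_m| = (2m+1)³`
then `{|C(0)| ≥ n} ⊆ {0 ↔ ∂Λ_m}` for configurations using lattice edges only (an almost sure event),
so `P_p(|C(0)| ≥ n) ≤ P_p(0 ↔ ∂Λ_m)` (Grimmett 1999, §1.4, first-exit argument). [folklore] -/
theorem real_clusterSizeGe_le_real_siteToBoundary (p : unitInterval) {m n : ℕ}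
    (hmn : (box 3 m).card < n) :
    (Pp p).real (clusterSizeGe (0 : V3) n) ≤ (Pp p).real (siteToBoundary 3 m) := by
  unfold Pp
  refine DCT16.real_mono_of_forall_subset_edgeSet (zdGraph 3) p fun ω hω h => ?_
  obtain ⟨z, hz, hzn⟩ : ∃ z ∈ openCluster ω 0, z ∉ box 3 m := by
    by_contra hcon
    push Not at hcon
    have hsub : openCluster ω 0 ⊆ (↑(box 3 m) : Set V3) := fun z hz => Finset.mem_coe.2 (hcon z hz)
    have h1 : (openCluster ω 0).encard ≤ ((box 3 m).card : ℕ∞) := by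
      rw [← Set.encard_coe_eq_coe_finsetCard]
      exact Set.encard_le_encard hsub
    rw [mem_clusterSizeGe] at h
    have h2 : (n : ℕ∞) ≤ ((box 3 m).card : ℕ∞) := h.trans h1
    exact absurd (by exact_mod_cast h2) (not_le.2 hmn)
  rw [← DCT16.armEvent_zero]
  exact DCT16.armEvent_of_pathIn hω (DCT16.pathIn_univ_of_reachable hz) (Or.inl (by rwa [sub_zero]))

/-- **First moment for the maximum of the induced half-space percolation, crude form**: for
`Λ = halfBox r` and `n ≥ 1`, `P^ℍ_p(|K_max(Λ)| ≥ n) ≤ n · P^ℍ_p(|K_max(Λ)| ≥ n) ≤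
Σ_{v ∈ Λ} P^ℍ_p(|K_v ∩ Λ| ≥ n) ≤ |Λ| · P_p(|C(0)| ≥ n)` (Markov on the number of `v ∈ Λ` with
`|K_v ∩ Λ| ≥ n`, `P^ℍ_p ≤ P_p` on increasing events, translation invariance; Hutchcroft 2021,
proof of Thm 2.1). [folklore] -/
theorem real_clusterMaxIn_ge_floorDiluted_le_card_mul (p : unitInterval) (r : ℕ) {n : ℕ}
    (hn : 1 ≤ n) :
    (floorDilutedPercolation 3 p 1).real {ω | n ≤ clusterMaxIn (halfBox r) ω} ≤
      ((halfBox r).card : ℝ) * (Pp p).real (clusterSizeGe (0 : V3) n) := by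
  have h1 := StubTypicalMaxBound.mul_real_clusterMaxIn_ge_le_sum (floorDilutedPercolation 3 p 1)
    (halfBox_nonempty_fm r) n
  have h2 : ∑ v ∈ halfBox r, (floorDilutedPercolation 3 p 1).real
      {ω | n ≤ clusterCapIn (halfBox r) ω v} ≤
        ((halfBox r).card : ℝ) * (Pp p).real (clusterSizeGe (0 : V3) n) := by
    rw [← nsmul_eq_mul, ← sum_const]
    exact sum_le_sum fun v _ => real_clusterCapIn_ge_floorDiluted_le p (halfBox r) v n
  have h0 : 0 ≤ (floorDilutedPercolation 3 p 1).real {ω | n ≤ clusterMaxIn (halfBox r) ω} :=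
    measureReal_nonneg
  have hn' : (1 : ℝ) ≤ n := by exact_mod_cast hn
  calc (floorDilutedPercolation 3 p 1).real {ω | n ≤ clusterMaxIn (halfBox r) ω}
      = 1 * (floorDilutedPercolation 3 p 1).real {ω | n ≤ clusterMaxIn (halfBox r) ω} :=
        (one_mul _).symm
    _ ≤ (n : ℝ) * (floorDilutedPercolation 3 p 1).real {ω | n ≤ clusterMaxIn (halfBox r) ω} :=
        mul_le_mul_of_nonneg_right hn' h0
    _ ≤ _ := h1.trans h2

/-! ## §2 The subcritical typical maximum is polylogarithmic -/

/-- **STUB (W-neg, 1/2) — subcritical typical maximum of the induced half-space percolation is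
polylogarithmic.** For `p < p_c(ℤ³)` there is `C = C_p` with
`typicalMax P^ℍ_p (halfBox r) ≤ C (1 + log r)³` for all `r ≥ 1`: sharpness
(`P_p(0 ↔ ∂Λ_m) ≤ e^{-cm}`, Duminil-Copin–Tassion 2016) and first exit give
`P_p(|C(0)| ≥ (2m+1)³ + 1) ≤ e^{-cm}`; the first moment for the maximum gives
`P^ℍ_p(|K_max(Λ_r)| ≥ (2m+1)³ + 1) ≤ 27 r³ e^{-cm} ≤ e^{-1}` for `m = ⌈(27 + 3 log r)/c⌉`, so
`typicalMax ≤ (2m+1)³ + 1 ≤ ((54/c + 3)³ + 1)(1 + log r)³`. [folklore] -/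
theorem typicalMax_le_log_cube_of_lt_criticalProb :
    ∀ (p : unitInterval), (p : ℝ) < criticalProb (zdGraph 3) (0 : V3) → ∃ C : ℝ, ∀ r : ℕ, 1 ≤ r →
      (typicalMax (floorDilutedPercolation 3 p 1) (halfBox r) : ℝ) ≤ C * (1 + Real.log r) ^ 3 := by
  intro p hp
  obtain ⟨c, hc, hdec⟩ := DCT16.perc_sharpness_holds (d := 3) (by norm_num) p hp
  refine ⟨(54 / c + 3) ^ 3 + 1, fun r hr => ?_⟩
  have hr' : (1 : ℝ) ≤ r := by exact_mod_cast hr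
  have hr0 : (0 : ℝ) < r := by linarith
  have hlog : 0 ≤ Real.log r := Real.log_nonneg hr'
  -- the box radius `m` and the volume threshold `n = (2m+1)³ + 1`
  set t : ℝ := (27 + 3 * Real.log r) / c with ht
  have ht0 : 0 ≤ t := div_nonneg (by linarith) hc.le
  obtain ⟨m, hm⟩ : ∃ m : ℕ, m = ⌈t⌉₊ := ⟨_, rfl⟩
  have htm : t ≤ m := hm ▸ Nat.le_ceil t
  have hmt : (m : ℝ) < t + 1 := hm ▸ Nat.ceil_lt_add_one ht0
  obtain ⟨n, hn⟩ : ∃ n : ℕ, n = (2 * m + 1) ^ 3 + 1 := ⟨_, rfl⟩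
  have hn1 : 1 ≤ n := by rw [hn]; exact Nat.le_add_left 1 _
  have hbox : (box 3 m).card < n := by rw [card_box, hn]; exact Nat.lt_succ_self _
  -- `c m ≥ 27 + 3 log r`, so `27 r³ e^{-cm} ≤ e^{-1}`
  have hcm : 27 + 3 * Real.log r ≤ c * m := by
    have h1 : c * t = 27 + 3 * Real.log r := by rw [ht]; field_simp
    have h2 : c * t ≤ c * m := mul_le_mul_of_nonneg_left htm hc.le
    linarith
  have hkey : 27 * (r : ℝ) ^ 3 * Real.exp (-c * m) ≤ Real.exp (-1) := by
    have hlog27 : Real.log 27 ≤ 26 := by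
      have := Real.log_le_sub_one_of_pos (by norm_num : (0 : ℝ) < 27); linarith
    have h1 : Real.log (27 * (r : ℝ) ^ 3) ≤ c * m - 1 := by
      rw [Real.log_mul (by norm_num) (pow_pos hr0 3).ne', Real.log_pow]
      push_cast
      linarith
    have h2 : 27 * (r : ℝ) ^ 3 ≤ Real.exp (c * m - 1) :=
      (Real.log_le_iff_le_exp (by positivity)).1 h1
    calc 27 * (r : ℝ) ^ 3 * Real.exp (-c * m) ≤ Real.exp (c * m - 1) * Real.exp (-c * m) :=
        mul_le_mul_of_nonneg_right h2 (Real.exp_pos _).le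
      _ = Real.exp (-1) := by rw [← Real.exp_add]; congr 1; ring
  -- Step 1: `typicalMax ≤ n` by minimality of the typical value
  have hM : typicalMax (floorDilutedPercolation 3 p 1) (halfBox r) ≤ n := by
    refine Nat.sInf_le ?_
    show (floorDilutedPercolation 3 p 1).real {ω | n ≤ clusterMaxIn (halfBox r) ω} ≤ Real.exp (-1)
    have hdec' : (Pp p).real (siteToBoundary 3 m) ≤ Real.exp (-c * m) := hdec m
    calc (floorDilutedPercolation 3 p 1).real {ω | n ≤ clusterMaxIn (halfBox r) ω}
        ≤ ((halfBox r).card : ℝ) * (Pp p).real (clusterSizeGe (0 : V3) n) :=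
          real_clusterMaxIn_ge_floorDiluted_le_card_mul p r hn1
      _ ≤ ((halfBox r).card : ℝ) * (Pp p).real (siteToBoundary 3 m) :=
          mul_le_mul_of_nonneg_left (real_clusterSizeGe_le_real_siteToBoundary p hbox)
            (Nat.cast_nonneg _)
      _ ≤ 27 * (r : ℝ) ^ 3 * Real.exp (-c * m) :=
          mul_le_mul (card_halfBox_le hr) hdec' measureReal_nonneg (by positivity)
      _ ≤ Real.exp (-1) := hkey
  -- Step 2: `n ≤ ((54/c + 3)³ + 1) (1 + log r)³`
  set L : ℝ := 1 + Real.log r with hL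
  have hL1 : 1 ≤ L := by rw [hL]; linarith
  have hL0 : 0 ≤ L := le_trans zero_le_one hL1
  have hc0 : 0 ≤ 54 / c + 3 := by positivity
  have htL : t ≤ 27 * L / c := by
    rw [ht, hL]
    exact div_le_div_of_nonneg_right (by linarith) hc.le
  have hmL : (m : ℝ) ≤ (27 / c + 1) * L := by
    have : 27 * L / c + 1 ≤ 27 * L / c + L := by linarith
    calc (m : ℝ) ≤ t + 1 := hmt.le
      _ ≤ 27 * L / c + 1 := by linarith
      _ ≤ 27 * L / c + L := this
      _ = (27 / c + 1) * L := by ring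
  have h2m : (2 * (m : ℝ) + 1) ≤ (54 / c + 3) * L := by
    have : (54 / c + 3) * L = 2 * ((27 / c + 1) * L) + L := by ring
    rw [this]; linarith
  have hnR : (n : ℝ) = (2 * (m : ℝ) + 1) ^ 3 + 1 := by rw [hn]; push_cast; ring
  have hnL : (n : ℝ) ≤ ((54 / c + 3) ^ 3 + 1) * L ^ 3 := by
    rw [hnR]
    have h1 : (2 * (m : ℝ) + 1) ^ 3 ≤ ((54 / c + 3) * L) ^ 3 :=
      pow_le_pow_left₀ (by positivity) h2m 3
    have h2 : (1 : ℝ) ≤ L ^ 3 := one_le_pow₀ hL1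
    calc (2 * (m : ℝ) + 1) ^ 3 + 1 ≤ ((54 / c + 3) * L) ^ 3 + L ^ 3 := add_le_add h1 h2
      _ = ((54 / c + 3) ^ 3 + 1) * L ^ 3 := by ring
  calc (typicalMax (floorDilutedPercolation 3 p 1) (halfBox r) : ℝ) ≤ n := by exact_mod_cast hM
    _ ≤ ((54 / c + 3) ^ 3 + 1) * L ^ 3 := hnL

/-! ## §3 The log-free ARROW 1 is false below `p_c` -/

/-- **STUB (W-neg, 2/2) — ARROW 1's logarithm is necessary uniformly in `p`.** For
`0 < p < p_c(ℤ³)` there is NO constant `K` with `M_p(r) ≤ K · typicalMax P^ℍ_p (halfBox r) · π_p(r)`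
for all `r ≥ 1`: with `M_p(r) ≥ (r+1) π_p(r)` (`succ_mul_armProb_le_mass`), `π_p(r) > 0`
(`armProb_pos`) and `typicalMax ≤ C (1 + log r)³` (`typicalMax_le_log_cube_of_lt_criticalProb`)
it would give `r + 1 ≤ K C (1 + log r)³ ≤ 125 K C r^{3/4}` for all `r ≥ 1` (`log r ≤ 4 r^{1/4}`),
absurd. [folklore] -/
theorem not_massLeTypicalMax_logfree_of_lt_criticalProb :
    ∀ (p : unitInterval), 0 < (p : ℝ) → (p : ℝ) < criticalProb (zdGraph 3) (0 : V3) →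
      ¬ ∃ K : ℝ, ∀ r : ℕ, 1 ≤ r → mass p r ≤
        K * (typicalMax (floorDilutedPercolation 3 p 1) (halfBox r) : ℝ) * armProb p r := by
  intro p hp0 hp
  rintro ⟨K, hK⟩
  obtain ⟨C, hC⟩ := typicalMax_le_log_cube_of_lt_criticalProb p hp
  set A : ℝ := max K 1 * max C 1 with hA
  have hK1 : (0 : ℝ) ≤ max K 1 := le_trans zero_le_one (le_max_right _ _)
  have hA0 : 0 ≤ A := mul_nonneg hK1 (le_trans zero_le_one (le_max_right _ _))
  -- for every `r ≥ 1`: `r + 1 ≤ A (1 + log r)³`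
  have key : ∀ r : ℕ, 1 ≤ r → (r : ℝ) + 1 ≤ A * (1 + Real.log r) ^ 3 := by
    intro r hr
    have hr' : (1 : ℝ) ≤ r := by exact_mod_cast hr
    have hπ := armProb_pos hp0 r
    have h1 := (succ_mul_armProb_le_mass p r).trans (hK r hr)
    have h2 : (r : ℝ) + 1 ≤ K * (typicalMax (floorDilutedPercolation 3 p 1) (halfBox r) : ℝ) :=
      le_of_mul_le_mul_right h1 hπ
    have hM0 : (0 : ℝ) ≤ (typicalMax (floorDilutedPercolation 3 p 1) (halfBox r) : ℝ) :=
      Nat.cast_nonneg _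
    have hL : 0 ≤ (1 + Real.log r) ^ 3 := pow_nonneg (by linarith [Real.log_nonneg hr']) 3
    calc (r : ℝ) + 1 ≤ K * (typicalMax (floorDilutedPercolation 3 p 1) (halfBox r) : ℝ) := h2
      _ ≤ max K 1 * (typicalMax (floorDilutedPercolation 3 p 1) (halfBox r) : ℝ) :=
          mul_le_mul_of_nonneg_right (le_max_left _ _) hM0
      _ ≤ max K 1 * (C * (1 + Real.log r) ^ 3) := mul_le_mul_of_nonneg_left (hC r hr) hK1
      _ ≤ max K 1 * (max C 1 * (1 + Real.log r) ^ 3) :=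
          mul_le_mul_of_nonneg_left (mul_le_mul_of_nonneg_right (le_max_left _ _) hL) hK1
      _ = A * (1 + Real.log r) ^ 3 := by rw [hA]; ring
  -- `(1 + log r)³ ≤ 125 r^{3/4}`, contradicting `r ≤ 125 A r^{3/4}` for large `r`
  refine not_forall_rpow_le (c := 1) (C := 125 * A) (s := 3 / 4) (t := 1) one_pos (by norm_num)
    fun r hr => ?_
  rw [Real.rpow_one, one_mul]
  have hr' : (1 : ℝ) ≤ r := by exact_mod_cast hr
  have hr0 : (0 : ℝ) ≤ r := le_trans zero_le_one hr'
  have hlog : Real.log r ≤ (r : ℝ) ^ (1 / 4 : ℝ) / (1 / 4) := Real.log_le_rpow_div hr0 (by norm_num)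
  have hq1 : 1 ≤ (r : ℝ) ^ (1 / 4 : ℝ) := Real.one_le_rpow hr' (by norm_num)
  have hL5 : 1 + Real.log r ≤ 5 * (r : ℝ) ^ (1 / 4 : ℝ) := by
    have : (r : ℝ) ^ (1 / 4 : ℝ) / (1 / 4) = 4 * (r : ℝ) ^ (1 / 4 : ℝ) := by ring
    linarith
  have hL0 : 0 ≤ 1 + Real.log r := by linarith [Real.log_nonneg hr']
  have hcube : (1 + Real.log r) ^ 3 ≤ 125 * (r : ℝ) ^ (3 / 4 : ℝ) := by
    calc (1 + Real.log r) ^ 3 ≤ (5 * (r : ℝ) ^ (1 / 4 : ℝ)) ^ 3 := pow_le_pow_left₀ hL0 hL5 3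
      _ = 125 * ((r : ℝ) ^ (1 / 4 : ℝ)) ^ 3 := by ring
      _ = 125 * (r : ℝ) ^ (3 / 4 : ℝ) := by
          rw [← Real.rpow_mul_natCast hr0]
          norm_num
  calc (r : ℝ) ≤ (r : ℝ) + 1 := by linarith
    _ ≤ A * (1 + Real.log r) ^ 3 := key r hr
    _ ≤ A * (125 * (r : ℝ) ^ (3 / 4 : ℝ)) := mul_le_mul_of_nonneg_left hcube hA0
    _ = 125 * A * (r : ℝ) ^ (3 / 4 : ℝ) := by ring

end Summit.CriticalPhenomena.PercolationContinuityZ3.Theorems.TallClusterMassBound.TightnessLine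

end
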